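import Literature.MathematicalPhysics.QuantumFieldTheory.Balaban1983to89.T4HistoryPeeling

/-!
# `Balaban1983to89.T4OverdueHorizon` — the two-rate slot budget of node U5c (spine estimate NE7b, renewal member P2)
under the CELL's level schedule [CONV-D] of RULING R-ηW: the event cover of the cell's reading R2 stops at the last
PERFORMED complete ℝ operation, `D = N_W + 1` levels below the cutoff, and `T4HistoryPeeling.slotBudget_le` survives with
ONE explicit deficit factor `σ⁻¹ ^ D = exp(D · log σ⁻¹)` on its constant — located obligation **O-ηW-β** in discharge
form (ii) («EXPLICIT DEFICIT»), with the K-free smallness threshold of the weight DISPLAYED, and the declaration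
**O-ηW-δ** for the renewal lineage's leaves (cell `pub-balaban`, T4-DAG §8 Q24(a) self-row T4-U5c.E-NE7b-OVERDUE-K*,
node U5c / U5.E, generation 16; record `t4/T4-EST-NE7b-P2.md` v3.8 §5 item v24; kernel bookkeeping over
`T4HistoryPeeling` (+ `T4WeightBudget` through it); additive leaf, no sibling module modified)

HONEST FRAMING (T4-DAG PAGE 1).  The cell's T4 target is the existence and uniqueness of the `ε → 0` limit of unit-scale
block-averaged expectations on a FIXED finite torus, at rung (B)+1, CONDITIONAL on Bałaban's ultraviolet stability (B)
and on BetaPertH; it is NOT infinite volume, NOT the mass gap, NOT the Clay problem.  This module is [folklore] real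
arithmetic (natural-number truncated subtraction, powers, geometric majorants, `Real.exp` / `Real.log`).  NOTHING of
Bałaban's is asserted, no printed sentence is used as a hypothesis, no `def … : Prop` fact is minted.  THE SCHEDULE IS THE
CELL'S, NOT PRINT'S (R-ηW-7): print heals every eligible component at every level; the η-design's runs A (cutoff `K`) and
B (cutoff `K + 1`) are «print-literal except: no complete ℝ at the N_W + 1 youngest levels of either run (cell convention
R-ηW)» (`t4/T4-REF-U5.md` v1.4.19 §19, ruling R-ηW-1; GAPS G-pv06g25-2).  A docstring below that says «under [CONV-D]»
speaks of that cell convention and of nothing in the papers.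

CITATION HEADER (locators and context only; every «…» was READ BY THIS SEAT ON THE RENDERED JOURNAL PAGE, PNG ×2, this
generation).
* [Balaban1989LargeFieldI] = T. Bałaban, *Large field renormalization. I. The basic step of the ℝ operation*, Commun.
  Math. Phys. **122** (1989) 175–202 (cell paper B15; renders `b2b-balaban-ref1/pages/1989-cmp122-large-field-I/
  1989-cmp122-large-field-I-pNNN-x2.png`, journal page = NNN + 174).  p. 175 [p001]: «Thus, for some large field regions
  there is a difficulty in continuing the procedure of [16], the small factor arising from large fields in this region
  does not control further steps. In such situations we have to change the procedure in order to improve the small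
  factor, i.e., we have to be able to renormalize the expression corresponding to the large field region.» (the HAZARD
  the ruling names, its L42).  p. 177 [p003], the class of components on which ℝ acts: «We consider the class of
  components such that each satisfies the following two properties: (i) it is contained in a cube of the size 100MR_k,
  (ii) in the preceding N renormalization steps no new large field regions were created inside this component, and the
  previous regions contained in it satisfy the condition (i) on the corresponding scales.» and «Conditions on N will be
  formulated in constructions of this section.» — the printed ELIGIBILITY rule behind the cell's reading R2 («a structure
  still pending N event-free steps after its last event is renormalised at the next performed ℝ»; `T4WeightBudget`
  v1.1 §3, `T4HistoryPeeling` §4; the cell's N′ = R + n₁ + O(log_L d′) of `t4/T4-XREAD-U5c.md` V5 is a reading, not a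
  quotation).
* [Balaban1989LargeFieldII] = T. Bałaban, *Large field renormalization. II*, Commun. Math. Phys. **122** (1989) 355–392
  (B16; renders `…/1989-cmp122-large-field-II/…-pNNN-x2.png`, journal page = NNN + 354).  p. 361 [p007]: «We have
  assumed here that N ≤ R_k.» (the one printed constraint on N this seat has read; the window `K`, its reset «K = R_{j+1}»
  and the merger bound «K ≤ K₂ + n₁ + R_{j+1}» of p. 386–387 are quoted in the header of `T4WeightBudget` v1.1 and model
  the EVENTS of R2).
WHAT THESE PAGES DO NOT PRINT (and this module does NOT assert): any level schedule other than healing every eligible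
component; any bound for a component left un-healed past its eligibility; the relative weight bound NE7b itself; the
single-slot domination `T4HistoryPeeling.SlotDom` (wall G-ne7bp2-1, census v12 of the record: the per-event RELATIVE
price is not printed).  All of these stay hypotheses / the cell's readings exactly as in `T4HistoryPeeling`.

THE RULING'S QUESTION TO THIS LINEAGE (R-ηW-4 (β), obligation O-ηW-β = rider Lq-27.4; verbatim core): «idem for the young
relative weights and the Bad budget — and since `hlt` needs W_K + Σ_a n(a)·lipWeight·ρ(a) < 1, “absorbed K-freely” is NOT
enough: W_K must stay SMALL and K-free with the overdue population of G-ne7cp2-9 counted»; discharge «either (i)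
SCHEDULE-FREE — name the hypothesis list the bound uses and observe none refers to the healing schedule; or (ii) EXPLICIT
DEFICIT — a factor ≤ exp(c₁ · (N_W + 1) · Σ_i w(X_i)) over the overdue components X_i, with c₁ K-free and w print's
per-component size weight at the component's scale, absorbed into the supplier's constant with the absorption shown
K-free».  The hazard (R-ηW-4): «under [CONV-D] a component that print would heal at an age ≤ N_W stays un-healed for at
most N_W + 1 further levels …, carrying small factors that print treats as possibly spent.»

THE ANSWER, IN RENEWAL CURRENCY (what is typed below; the READING is the cell's, the ARITHMETIC is the kernel's).
WHERE THE SCHEDULE ENTERS THE RENEWAL CHAIN — at exactly ONE binder.  Of the three typed ingredients of the slot budget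
(`T4HistoryPeeling` §4: R1 event cost `c r ≤ ρ^{m r}`, record / birth entropy `Γ^k`, `V·Λ^{K − j₀}` (R4), and R2's
minimum event count), only R2 reads the healing schedule: «every step x ∈ [j, K] of a structure born at j and still
pending at the cutoff K lies less than N steps after one of its events, ELSE THE ℝ PERFORMED AT STEP x WOULD HAVE
RENORMALISED IT» (`T4WeightBudget.card_Icc_le_of_windows`: `K + 1 − j ≤ N·#events`).  Healing-when-eligible is invoked
there as the cell's reading of the printed eligibility rule p. 177 (i)/(ii) AT PERFORMED LEVELS — never as a B15 §1 /
B16 §1 inductive hypothesis.  Under [CONV-D] the complete ℝ is performed only at the levels of age `≥ D := N_W + 1`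
(R-ηW-5, reading [T-a]: the last performed ℝ sits at age N_W + 1), so «pending at cutoff K» licenses the cover only on
`[j, K − D]`: `K − D + 1 − j ≤ N·#events` (`pow_events_le_of_horizon_cover`), i.e. the structure may have up to `D/N`
FEWER forced events than print's schedule would force — these are exactly the ruling's «small factors that print treats as
possibly spent», here: never earned.  Everything else is schedule-free: R1 prices an event when it HAPPENS (region
creation (1.79), merger surplus), R4 / record entropy count birth positions, shapes and records, and the OVERDUE
POPULATION of G-ne7cp2-9 (old structures eligible at a window age and left un-healed) is a SUBSET of the old structures
pending at the cutoff — already inside `Bad K t` and inside the count `V·Λ^{K − j₀}`; no new population, only a weaker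
cost per member.  (Young structures, born at `j ≥ j⋆(K)`, overdue or not, are not in `Bad`: they are age-aligned in both
runs and belong to the matched part — obligation O-ηW-α of node U5b, not this node.)
THE DEFICIT, TYPED (§1–§2).  Per old slot the cost hypothesis of `slotBudget_le` weakens from `x i ≤ C·σ^{K − j i}` to
`x i ≤ C·σ^{K − D − j i}` and `σ^{(K − j) − D} ≤ σ⁻¹^D · σ^{K − j}` (`pow_sub_le_inv_pow_mul`, `0 < σ ≤ 1`, truncated
subtraction included), so **`slotBudget_le_of_horizon`**: `Σ_i x i ≤ C·σ⁻¹^D·V·(Λσ)^{K − j⋆ + 1}/(1 − Λσ)` — the SAME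
two-rate budget with the constant `C ↦ C·σ⁻¹^D`.  In the ruling's letters: deficit factor `exp(c₁·(N_W + 1))` per old
pending structure with `c₁ = log σ⁻¹` (`inv_exp_neg_pow`: for `σ = exp(−s)`, `σ⁻¹^D = exp(D·s)`; in the dictionary of
`T4HistoryPeeling.pow_eventCount_le_twoRate`, `s = (p − E)/N` = banked event cost minus event entropy per step of an
event-free epoch), which is `≤ exp(c₁·(N_W + 1)·w(X))` for any size weight `w(X) ≥ 1` — form (ii) with room to spare; the
absorption is the constant swap `C ↦ C·exp(c₁·D)`, K-free because `c₁` and `D ≤ N₀ + 1` are (`c₁` inherits the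
K-freeness of the instantiation's letters p̄₀, E, N exactly as the undeficited budget does — the standing BetaPertH /
(B^μ) conditionals of the record, hidden nowhere — and N_W ≤ N₀ is P-1′ / 27.3 (c3) of `t4/T4-EST-U5bE2.md`).  NO NEW
DEPENDENCE ON K IS INTRODUCED; the CONDITION of the node (`T4WeightBudget.survivalRate_pos_iff`: `Λσ < 1 ⟺ p/N > 4 log L
+ E/N`) is UNCHANGED, because the deficit multiplies the budget by a constant and leaves its geometric rate alone.
SMALL AND K-FREE, WITH THE NUMBER (§3; the ruling's «absorbed K-freely is NOT enough»).  With the old fraction `c·K ≤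
K − j⋆(K)` the undeficited budget is `≤ M·ϱ^K`, `M = C·V·r/(1 − r)`, `ϱ = r^c`, `r = Λσ` (`twoRateBudget_le_geometric`),
hence the weight `W_K = 1 − exp(−S_D K) ≤ S_D K = σ⁻¹^D·S K` obeys **`horizonWeight_lt`**: `W_K < ε` for every `K` with
`log(M/ε) + D·log σ⁻¹ < K·log ϱ⁻¹` — the threshold moves by exactly `D·log σ⁻¹/(c·log r⁻¹)` steps (`log_inv_rpow`) and by
nothing depending on `K`; summability over `K` (`summable_horizonBudget`) and the assembled
**`relWeightBound_of_slotDom_horizon`** (= `T4HistoryPeeling.relWeightBound_of_slotDom_twoRate` at `C·σ⁻¹^D`) follow.  Run B (cutoff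
`K + 1`) has the same `D` relative to ITS cutoff; the common budget indexed by the pair index `K` absorbs the one-step
offset into `C` as before (`T4HistoryPeeling.relWeightBound_of_slotDom_twoRate` takes ONE budget for both runs).
DECLARATION O-ηW-δ FOR THE RENEWAL LINEAGE (form (i), by type; the ten accepted leaves `T4PersistenceRenewal`,
`T4PersistenceGrove`, `T4RenewalChains`, `T4GlobalDenominator`, `T4LiveClassFibration`, `T4LiveGasToTerms`,
`T4MarginalRenewal`, `T4StabilitySocket`, `T4StabilityFloor`, `T4StabilityFloorUnitary`, and `T4HistoryPeeling` /
`T4WeightBudget` which they serve): every exported theorem quantifies over abstract term families, slot / record / class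
data and displayed binders; NO hypothesis list refers to a level schedule, and NONE invokes a B15 §1 / B16 §1 inductive
hypothesis.  The one print pin of the lineage, `(hB : B16.EndStatementBPrinted C)` in `T4StabilitySocket` /
`T4StabilityFloor` / `T4StabilityFloorUnitary`, is Cor. 3 (2.50)-lower at the final scale `k = K` of the PRINTED procedure
and enters only INTEGRATED, as a lower bound on the number `∫ρ_K dV_K = c·Z_ε` — a number the ruling itself certifies
schedule-independent (R-ηW-2: (0.4) / (1.102) / `T4DressedR.lintegral_rop03_dressed`); so the (GD) denominator fields
(`low`, `ratio`, the floor `c₀`) carry NO deficit, PROVIDED the instantiating seat discharges binder (α) (`hα`: dressed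
fine-lattice integral ≤ the run's full term sum) for the [CONV-D] term family — whose full sum is that same number.  The
schedule-reading binder of the whole chain is R2's `hcost`, re-typed here with its horizon; if an instantiation ever needs
`D` growing with `K` (or `N(g_k)` beyond the cap `N₀`), R-ηW-6 applies and [CONV-D] is suspended for node U5c — nothing
below would then be false, only unusable.

WHAT IS PROVED (0 `sorry`; all [folklore]).
§1 `pow_sub_le_inv_pow_mul` (`σ^{(a − D)} ≤ σ⁻¹^D·σ^a` for `0 < σ ≤ 1`, ℕ-subtraction), `one_le_inv_pow`,
   `inv_pow_mono` (the deficit grows with the window depth), `inv_exp_neg_pow` (`(e^{−s})⁻¹^D = e^{D·s}`),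
   `exp_mul_le_exp_mul_mul` (a size weight `w ≥ 1` only enlarges the licence), `pow_events_le_of_horizon_cover` (R2 with
   horizon: cover on `[j, K − D]` ⇒ `q^{#S − 1} ≤ q⁻¹·(q^{1/N})^{K − D + 1 − j}`).
§2 `slotBudget_le_of_horizon` (the two-rate slot budget with `hcost : x i ≤ C·σ^{K − D − j i}`; constant `C·σ⁻¹^D`),
   `horizonBudget_eq` / `horizonBudget_zero` (`D = 0` is `slotBudget_le`'s budget verbatim).
§3 `twoRateBudget_le_geometric`, `mul_pow_lt_of_log_lt`, `deficit_mul_pow_lt_of_log_lt`, `log_inv_rpow`,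
   `summable_horizonBudget`, **`horizonWeight_lt`** (explicit K-free threshold), **`relWeightBound_of_slotDom_horizon`**.
Deliberately NOT here: the instantiation (which term family, which `Bad`, the dictionary `uK` / `uLoc`; instantiating
seats under D-SEQ), the value of N_W (pv07's η-design), the numerator-side records budget of member P1
(`T4CanonicalMenus` / `T4TaggedShapeBanking`: its `reach` / `Ncap` horizon is P1's to declare), node U5b's O-ηW-α
(answered on the shell-measure side, journal post-rotation l.605), and wall G-ne7bp2-1 (unchanged).
-/

open Finset _root_.Filter _root_.Topology

namespace Literature.MathematicalPhysics.QuantumFieldTheory.Balaban1983to89.T4OverdueHorizon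

open T4WeightBudget T4HistoryPeeling

/-! ## §1 Arithmetic of the horizon shift (truncated subtraction, the deficit factor, R2 with horizon) -/

section Arithmetic

/-- THE DEFICIT INEQUALITY: for `0 < σ ≤ 1` and natural numbers `a, D` (truncated subtraction),
`σ^{a − D} ≤ σ⁻¹^D · σ^a` — equality when `D ≤ a`, and `1 ≤ σ^{−(D − a)}` otherwise.  Read: losing up to `D` forced
epochs of decay costs at most the K-free factor `σ⁻¹^D`. [folklore] -/
theorem pow_sub_le_inv_pow_mul {σ : ℝ} (hσ0 : 0 < σ) (hσ1 : σ ≤ 1) (a D : ℕ) :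
    σ ^ (a - D) ≤ σ⁻¹ ^ D * σ ^ a := by
  have hD : 0 < σ ^ D := pow_pos hσ0 D
  rw [inv_pow, ← div_eq_inv_mul, le_div_iff₀ hD, ← pow_add]
  exact pow_le_pow_of_le_one hσ0.le hσ1 (by omega)

/-- The deficit factor is at least `1` (`0 < σ ≤ 1`). [folklore] -/
theorem one_le_inv_pow {σ : ℝ} (hσ0 : 0 < σ) (hσ1 : σ ≤ 1) (D : ℕ) : 1 ≤ σ⁻¹ ^ D :=
  one_le_pow₀ (one_le_inv_iff₀.2 ⟨hσ0, hσ1⟩)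

/-- … and monotone in the window depth: a deeper un-healed window costs more (`D ≤ D' ⇒ σ⁻¹^D ≤ σ⁻¹^{D'}`). [folklore] -/
theorem inv_pow_mono {σ : ℝ} (hσ0 : 0 < σ) (hσ1 : σ ≤ 1) {D D' : ℕ} (h : D ≤ D') : σ⁻¹ ^ D ≤ σ⁻¹ ^ D' :=
  pow_le_pow_right₀ (one_le_inv_iff₀.2 ⟨hσ0, hσ1⟩) h

/-- THE DEFICIT IN THE RULING'S LETTERS: with the per-step survival rate written `σ = exp(−s)` (dictionary of
`T4HistoryPeeling.pow_eventCount_le_twoRate`: `s = (p − E)/N`), `σ⁻¹^D = exp(D·s)` — i.e. `exp(c₁·(N_W + 1))` with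
`c₁ = s` and `D = N_W + 1`, form (ii) of R-ηW-4 per old pending structure (and `≤ exp(c₁·(N_W + 1)·w)` for any size
weight `w ≥ 1`). [folklore] -/
theorem inv_exp_neg_pow (s : ℝ) (D : ℕ) : (Real.exp (-s))⁻¹ ^ D = Real.exp (D * s) := by
  rw [Real.exp_neg, inv_inv, ← Real.exp_nat_mul]

/-- `exp(D·s) ≤ exp(D·s·w)` for `0 ≤ s`, `1 ≤ w` (the ruling's size weight `w(X) ≥ 1` only enlarges the licence).
[folklore] -/
theorem exp_mul_le_exp_mul_mul {s w : ℝ} (hs : 0 ≤ s) (hw : 1 ≤ w) (D : ℕ) :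
    Real.exp (D * s) ≤ Real.exp (D * s * w) := by
  rw [Real.exp_le_exp]
  have h : 0 ≤ (D : ℝ) * s := mul_nonneg (Nat.cast_nonneg D) hs
  nlinarith

/-- **R2 WITH HORIZON** (the cell's reading under [CONV-D], typed as counting): if every step `x ∈ [j, K − D]` — the
levels at which the complete ℝ is PERFORMED and the structure was nevertheless not renormalised — lies less than `N` steps
after some element of the event set `S` (birth included), then `K − D + 1 − j ≤ N·#S`
(`T4WeightBudget.card_Icc_le_of_windows` on the shortened stretch), whence with `0 < q ≤ 1` (`q = Γρ`) the event cost
`q^{#S − 1}` (events after birth) is `≤ q⁻¹·(q^{1/N})^{K − D + 1 − j}`.  Nothing is claimed about the window levels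
`K − D < x ≤ K`: there the cell's runs perform no complete ℝ, so «pending» forces no event. [folklore] -/
theorem pow_events_le_of_horizon_cover {q : ℝ} (hq0 : 0 < q) (hq1 : q ≤ 1) {N : ℕ} (hN : 0 < N) {j K D : ℕ}
    (S : Finset ℕ) (hcov : ∀ x ∈ Icc j (K - D), ∃ s ∈ S, s ≤ x ∧ x < s + N) :
    q ^ (S.card - 1) ≤ q⁻¹ * (q ^ ((1 : ℝ) / N)) ^ (K - D + 1 - j) := by
  have h := card_Icc_le_of_windows S hcov
  exact pow_eventCount_le_twoRate hq0 hq1 hN (h.trans (Nat.mul_le_mul_left N (by omega)))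

end Arithmetic

/-! ## §2 The two-rate slot budget with horizon `D` -/

section Budget

/-- **THE SLOT BUDGET UNDER [CONV-D]** — `T4HistoryPeeling.slotBudget_le` with R2's cost hypothesis weakened to the
horizon form `x i ≤ C·σ^{K − D − j i}` (`D = N_W + 1` un-healed youngest levels; `0 < σ ≤ 1`): the conclusion is the SAME
two-rate budget with the constant `C ↦ C·σ⁻¹^D`; entropy side (`hcount`, R4) and the rate `Λσ` untouched. [folklore] -/
theorem slotBudget_le_of_horizon {n : ℕ} (x : Fin n → ℝ) (j : Fin n → ℕ) {C V Λ σ : ℝ} (hC : 0 ≤ C) (hV : 0 ≤ V)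
    (hΛ : 0 ≤ Λ) (hσ0 : 0 < σ) (hσ1 : σ ≤ 1) (hr : Λ * σ < 1) {jstar K : ℕ} (hj : jstar ≤ K)
    (hold : ∀ i, j i < jstar)
    (hcount : ∀ j₀ < jstar, (((Finset.univ : Finset (Fin n)).filter fun i => j i = j₀).card : ℝ) ≤ V * Λ ^ (K - j₀))
    (D : ℕ) (hcost : ∀ i, x i ≤ C * σ ^ (K - D - j i)) :
    ∑ i, x i ≤ C * σ⁻¹ ^ D * V * ((Λ * σ) ^ (K - jstar + 1) / (1 - Λ * σ)) := by
  have hσD : 0 ≤ σ⁻¹ ^ D := pow_nonneg (inv_nonneg.2 hσ0.le) D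
  refine slotBudget_le x j (mul_nonneg hC hσD) hV hΛ hσ0.le hr hj hold hcount fun i => ?_
  calc x i ≤ C * σ ^ (K - D - j i) := hcost i
    _ = C * σ ^ (K - j i - D) := by rw [Nat.sub_right_comm]
    _ ≤ C * (σ⁻¹ ^ D * σ ^ (K - j i)) := mul_le_mul_of_nonneg_left (pow_sub_le_inv_pow_mul hσ0 hσ1 _ _) hC
    _ = C * σ⁻¹ ^ D * σ ^ (K - j i) := (mul_assoc _ _ _).symm

/-- The horizon budget IS the deficit factor times the undeficited two-rate budget of `T4HistoryPeeling`. [folklore] -/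
theorem horizonBudget_eq (C V r σ : ℝ) (D : ℕ) (jstar : ℕ → ℕ) (K : ℕ) :
    C * σ⁻¹ ^ D * V * (r ^ (K - jstar K + 1) / (1 - r)) =
      σ⁻¹ ^ D * (C * V * (r ^ (K - jstar K + 1) / (1 - r))) := by
  ring

/-- SANITY / TIGHTNESS: with no un-healed window (`D = 0`, print's schedule) the horizon budget is `slotBudget_le`'s
budget verbatim. [folklore] -/
theorem horizonBudget_zero (C V r σ : ℝ) (jstar : ℕ → ℕ) (K : ℕ) :
    C * σ⁻¹ ^ 0 * V * (r ^ (K - jstar K + 1) / (1 - r)) = C * V * (r ^ (K - jstar K + 1) / (1 - r)) := by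
  rw [pow_zero, mul_one]

end Budget

/-! ## §3 SMALL and K-free: the explicit threshold, summability, and the assembled `RelWeightBound` -/

section Small

/-- THE UNDEFICITED BUDGET IS GEOMETRIC IN `K` when a fraction `c` of the steps is old (`c·K ≤ K − j⋆(K)`):
`C·V·r^{K − j⋆(K) + 1}/(1 − r) ≤ M·ϱ^K` with `M = C·V·r/(1 − r)`, `ϱ = r^c` (the step inside
`T4WeightBudget.summable_weightMajorant`, exported). [folklore] -/
theorem twoRateBudget_le_geometric {C V r c : ℝ} (hC : 0 ≤ C) (hV : 0 ≤ V) (h0 : 0 < r) (h1 : r < 1)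
    {jstar : ℕ → ℕ} (hfrac : ∀ K : ℕ, c * K ≤ ((K - jstar K : ℕ) : ℝ)) (K : ℕ) :
    C * V * (r ^ (K - jstar K + 1) / (1 - r)) ≤ C * V * r / (1 - r) * (r ^ c) ^ K := by
  have key : r ^ (K - jstar K) ≤ (r ^ c) ^ K := by
    rw [← Real.rpow_natCast r (K - jstar K), ← Real.rpow_natCast (r ^ c) K, ← Real.rpow_mul h0.le]
    exact Real.rpow_le_rpow_of_exponent_ge h0 h1.le (hfrac K)
  have h1r : 0 < 1 - r := by linarith
  calc C * V * (r ^ (K - jstar K + 1) / (1 - r)) = C * V * r / (1 - r) * r ^ (K - jstar K) := by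
        rw [pow_succ]; ring
    _ ≤ C * V * r / (1 - r) * (r ^ c) ^ K :=
        mul_le_mul_of_nonneg_left key (div_nonneg (mul_nonneg (mul_nonneg hC hV) h0.le) h1r.le)

/-- A geometric quantity is below `ε` beyond an EXPLICIT threshold: `log(M/ε) < K·log ϱ⁻¹ ⇒ M·ϱ^K < ε`
(`0 < M, ϱ, ε`). [folklore] -/
theorem mul_pow_lt_of_log_lt {M ϱ ε : ℝ} (hM : 0 < M) (hϱ : 0 < ϱ) (hε : 0 < ε) {K : ℕ}
    (hK : Real.log (M / ε) < K * Real.log ϱ⁻¹) : M * ϱ ^ K < ε := by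
  have hK' : Real.log M - Real.log ε < -(K * Real.log ϱ) := by
    rw [Real.log_div hM.ne' hε.ne', Real.log_inv, mul_neg] at hK
    exact hK
  have h1 : Real.log (M * ϱ ^ K) < Real.log ε := by
    rw [Real.log_mul hM.ne' (pow_pos hϱ K).ne', Real.log_pow]
    linarith
  exact (Real.log_lt_log_iff (mul_pos hM (pow_pos hϱ K)) hε).1 h1

/-- … WITH THE DEFICIT: `log(M/ε) + D·log σ⁻¹ < K·log ϱ⁻¹ ⇒ σ⁻¹^D·(M·ϱ^K) < ε` — the threshold in `K` moves by EXACTLY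
`D·log σ⁻¹/log ϱ⁻¹` and by nothing that depends on `K`. [folklore] -/
theorem deficit_mul_pow_lt_of_log_lt {M ϱ ε σ : ℝ} (hM : 0 < M) (hϱ : 0 < ϱ) (hε : 0 < ε) (hσ : 0 < σ) (D : ℕ)
    {K : ℕ} (hK : Real.log (M / ε) + D * Real.log σ⁻¹ < K * Real.log ϱ⁻¹) :
    σ⁻¹ ^ D * (M * ϱ ^ K) < ε := by
  have hσD : 0 < σ⁻¹ ^ D := pow_pos (inv_pos.2 hσ) D
  rw [← mul_assoc]
  refine mul_pow_lt_of_log_lt (mul_pos hσD hM) hϱ hε ?_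
  rw [mul_div_assoc, Real.log_mul hσD.ne' (div_pos hM hε).ne', Real.log_pow, add_comm]
  exact hK

/-- The rate in the threshold: `log (r^c)⁻¹ = c·log r⁻¹` (`0 < r`), so with `ϱ = r^c` the shift reads
`D·log σ⁻¹/(c·log r⁻¹)`, `log r⁻¹ = survivalRate` in the dictionary of `T4WeightBudget.twoRate_majorant_le`. [folklore] -/
theorem log_inv_rpow {r : ℝ} (h0 : 0 < r) (c : ℝ) : Real.log (r ^ c)⁻¹ = c * Real.log r⁻¹ := by
  rw [Real.log_inv, Real.log_rpow h0, Real.log_inv, mul_neg]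

/-- SUMMABILITY OVER THE NUMBER OF STEPS of the horizon budget (`T4HistoryPeeling.summable_twoRateBudget` at the
constant `C·σ⁻¹^D`). [folklore] -/
theorem summable_horizonBudget {C V r c σ : ℝ} (hC : 0 ≤ C) (hV : 0 ≤ V) (h0 : 0 < r) (h1 : r < 1) (hc : 0 < c)
    (hσ : 0 < σ) (D : ℕ) {jstar : ℕ → ℕ} (hfrac : ∀ K : ℕ, c * K ≤ ((K - jstar K : ℕ) : ℝ)) :
    Summable fun K => C * σ⁻¹ ^ D * V * (r ^ (K - jstar K + 1) / (1 - r)) :=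
  summable_twoRateBudget (mul_nonneg hC (pow_nonneg (inv_nonneg.2 hσ.le) D)) hV h0 h1 hc hfrac

/-- **THE WEIGHT IS SMALL, WITH A K-FREE THRESHOLD (O-ηW-β: «W_K must stay SMALL and K-free»).**  With
`M = C·V·r/(1 − r)`, `ϱ = r^c` and the deficit `σ⁻¹^D`: `W_K = 1 − exp(−S_D K) < ε` for EVERY `K` with
`log(M/ε) + D·log σ⁻¹ < K·log ϱ⁻¹`.  All letters on the left are K-free when `C, V, r, c, σ, D, ε` are; the early steps
below the threshold go to `T4WeightBudget.relWeightBound_of_eventually` exactly as before. [folklore] -/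
theorem horizonWeight_lt {C V r c σ ε : ℝ} (hC : 0 < C) (hV : 0 < V) (h0 : 0 < r) (h1 : r < 1) (hσ : 0 < σ)
    (hε : 0 < ε) (D : ℕ) {jstar : ℕ → ℕ} (hfrac : ∀ K : ℕ, c * K ≤ ((K - jstar K : ℕ) : ℝ)) {K : ℕ}
    (hK : Real.log (C * V * r / (1 - r) / ε) + D * Real.log σ⁻¹ < K * Real.log (r ^ c)⁻¹) :
    1 - Real.exp (-(C * σ⁻¹ ^ D * V * (r ^ (K - jstar K + 1) / (1 - r)))) < ε := by
  have hM : 0 < C * V * r / (1 - r) := div_pos (mul_pos (mul_pos hC hV) h0) (by linarith)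
  have hϱ : 0 < r ^ c := Real.rpow_pos_of_pos h0 c
  calc 1 - Real.exp (-(C * σ⁻¹ ^ D * V * (r ^ (K - jstar K + 1) / (1 - r))))
      ≤ C * σ⁻¹ ^ D * V * (r ^ (K - jstar K + 1) / (1 - r)) := by
        -- `1 − e^{−S} ≤ S` from `−S + 1 ≤ e^{−S}` (in the tree as `LFunctions.PrimeReciprocal.one_sub_exp_neg_le`,
        -- not imported here)
        linarith [Real.add_one_le_exp (-(C * σ⁻¹ ^ D * V * (r ^ (K - jstar K + 1) / (1 - r))))]
    _ = σ⁻¹ ^ D * (C * V * (r ^ (K - jstar K + 1) / (1 - r))) := horizonBudget_eq C V r σ D jstar K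
    _ ≤ σ⁻¹ ^ D * (C * V * r / (1 - r) * (r ^ c) ^ K) :=
        mul_le_mul_of_nonneg_left (twoRateBudget_le_geometric hC.le hV.le h0 h1 hfrac K)
          (pow_nonneg (inv_nonneg.2 hσ.le) D)
    _ < ε := deficit_mul_pow_lt_of_log_lt hM hϱ hε hσ D hK

/-- **THE BUDGET END OF THE ROW UNDER [CONV-D], ASSEMBLED**: single-slot dominations of both runs with the HORIZON budget
`S_D K = C·σ⁻¹^D·V·r^{K − j⋆(K) + 1}/(1 − r)` (`0 < r < 1`, `0 < σ`, `c·K ≤ K − j⋆(K)`, non-negative weights) ⇒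
`T4WeightBudget.RelWeightBound` with weights `1 − exp(−S_D K)` — `T4HistoryPeeling.relWeightBound_of_slotDom_twoRate` at
the constant `C·σ⁻¹^D`; the deficit is visible in the weight and nowhere else. [folklore] -/
theorem relWeightBound_of_slotDom_horizon {ι : Type*} [DecidableEq ι] {l₀ : ℝ} {T : ℕ → Finset ι}
    {A B : ℕ → ℝ → ι → ℝ} {Bad : ℕ → ℝ → Finset ι} {C V r c σ : ℝ} (hC : 0 ≤ C) (hV : 0 ≤ V) (h0 : 0 < r)
    (h1 : r < 1) (hc : 0 < c) (hσ : 0 < σ) (D : ℕ) {jstar : ℕ → ℕ}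
    (hfrac : ∀ K : ℕ, c * K ≤ ((K - jstar K : ℕ) : ℝ))
    (hA : ∀ K t, |t| ≤ l₀ → ∀ τ ∈ T K, 0 ≤ A K t τ) (hB : ∀ K t, |t| ≤ l₀ → ∀ τ ∈ T K, 0 ≤ B K t τ)
    (hDA : SlotDom l₀ T A Bad fun K => C * σ⁻¹ ^ D * V * (r ^ (K - jstar K + 1) / (1 - r)))
    (hDB : SlotDom l₀ T B Bad fun K => C * σ⁻¹ ^ D * V * (r ^ (K - jstar K + 1) / (1 - r))) :
    RelWeightBound l₀ T A B Bad fun K => 1 - Real.exp (-(C * σ⁻¹ ^ D * V * (r ^ (K - jstar K + 1) / (1 - r)))) :=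
  relWeightBound_of_slotDom_twoRate (mul_nonneg hC (pow_nonneg (inv_nonneg.2 hσ.le) D)) hV h0 h1 hc hfrac hA hB hDA hDB

end Small

end Literature.MathematicalPhysics.QuantumFieldTheory.Balaban1983to89.T4OverdueHorizon
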